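import Mathlib

/-!
# Range avoidance for products of two affine forms over `𝔽₂` (rank-one quadratics) at `m ≥ 2n + 1`

Cell pnp-ideate (planner seat p3, ROUND-18 by-product B4; FRONTIER — an elementary restricted-model
ALGORITHMIC fact; nothing here bears on `P ≠ NP`).

Let `ℓ_i, ℓ'_i` (`i < m`) be affine forms on `𝔽₂ⁿ` and `F(x) = (ℓ_i(x)·ℓ'_i(x))_i` (every output the AND of
two parities of arbitrary arity, possibly shifted — e.g. the `k`-local tables `(x₀ ⊕ x₁) ∧ (x₂ ⊕ x₃)`,
`x₀ ∧ (x₁ ⊕ x₂ ⊕ x₃)`, `x₀ ∧ (x₁ ⊕ x₂)`; complemented outputs are handled by flipping target bits).  The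
following EXPLICIT RULE produces a point outside `Range F` whenever `m ≥ 2n + 1`, using rank computations
only (hence in polynomial time; the `IsPolyTime` typing is not done here):

* if the linear system `ℓ_i(x) = ℓ'_i(x) = 1 (∀ i)` is inconsistent, output `1^m` (`ones_not_mem_range`);
* otherwise pick a solution `x₀`; call `i` GOOD when both linear parts `λ_i, λ'_i` lie in the span `W_i` of
  the linear parts of the OTHER outputs; a good `i` exists (`exists_good`: the bad indices of each kind carry
  linearly independent linear parts, so there are at most `n + n < m` of them), and for a good `i` the point
  `1^m − e_i` is outside the range (`single_zero_not_mem_range`: a preimage `x` would have `x − x₀`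
  annihilating `W_i`, hence `ℓ_i(x) = ℓ'_i(x) = 1`).

This generalises the `a ∧ (b ⊕ c)` class argument of rung F-N1b (`Nc03AvoidResidualCoreReductionLinA`,
threshold `M > 2N`) to all rank-one quadratic output families, uniformly in the locality. [folklore-level
linear algebra; posed and proved in the cell, ROUND-18 §B4]
-/

set_option linter.dupNamespace false -- `Summit.PneNP.PneNP.…`: summit = sub-problem name (D-0017 single-conjunct layout)

namespace Summit.PneNP.PneNP.Theorems.RankOneQuadAvoid

open Finset BigOperators

variable {n m : ℕ}

/-- An affine form on `𝔽₂ⁿ`: linear part and constant. -/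
structure AffForm (n : ℕ) where
  /-- the linear part -/
  lin : Fin n → ZMod 2
  /-- the constant term -/
  const : ZMod 2

/-- Evaluation `ℓ(x) = ⟨λ, x⟩ + c`. -/
def AffForm.eval (ℓ : AffForm n) (x : Fin n → ZMod 2) : ZMod 2 := ∑ k, ℓ.lin k * x k + ℓ.const

/-- The rank-one quadratic map `x ↦ (ℓ_i(x) · ℓ'_i(x))_i`. -/
def prodMap (ℓ ℓ' : Fin m → AffForm n) (x : Fin n → ZMod 2) : Fin m → ZMod 2 :=
  fun i => (ℓ i).eval x * (ℓ' i).eval x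

/-- The span `W_i` of the linear parts of all outputs other than `i`. -/
def W (ℓ ℓ' : Fin m → AffForm n) (i : Fin m) : Submodule (ZMod 2) (Fin n → ZMod 2) :=
  Submodule.span (ZMod 2)
    (((fun j => (ℓ j).lin) '' {j | j ≠ i}) ∪ ((fun j => (ℓ' j).lin) '' {j | j ≠ i}))

/-- In `𝔽₂` a nonzero element is `1`. -/
theorem zmod2_eq_one_of_ne_zero (a : ZMod 2) (h : a ≠ 0) : a = 1 := by
  revert a; decide

/-- In `𝔽₂` a product is `1` iff both factors are. -/
theorem mul_eq_one_iff (a b : ZMod 2) : a * b = 1 ↔ a = 1 ∧ b = 1 := by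
  revert a b; decide

/-- Affine forms: `ℓ(x) = ℓ(x₀) + ⟨λ, x − x₀⟩`. -/
theorem AffForm.eval_eq (ℓ : AffForm n) (x x₀ : Fin n → ZMod 2) :
    ℓ.eval x = ℓ.eval x₀ + ∑ k, ℓ.lin k * (x - x₀) k := by
  simp only [AffForm.eval, Pi.sub_apply, mul_sub, Finset.sum_sub_distrib]
  ring

/-- **Rule 1.** If no `x` makes every form equal to `1`, the all-ones point is outside the range. -/
theorem ones_not_mem_range (ℓ ℓ' : Fin m → AffForm n)
    (h : ¬ ∃ x, ∀ i, (ℓ i).eval x = 1 ∧ (ℓ' i).eval x = 1) :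
    (fun _ => (1 : ZMod 2)) ∉ Set.range (prodMap ℓ ℓ') := by
  rintro ⟨x, hx⟩
  exact h ⟨x, fun i => (mul_eq_one_iff _ _).1 (by simpa [prodMap] using congrFun hx i)⟩

/-- The pairing `v ↦ ⟨v, u⟩` as a linear map. -/
def dotWith (u : Fin n → ZMod 2) : (Fin n → ZMod 2) →ₗ[ZMod 2] ZMod 2 where
  toFun v := ∑ k, v k * u k
  map_add' v w := by simp [add_mul, Finset.sum_add_distrib]
  map_smul' c v := by simp [Finset.mul_sum, mul_assoc]

/-- **Rule 2 (soundness).** If `x₀` makes every form `1` and both linear parts of output `i` lie in the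
span of the other outputs' linear parts, then `1^m − e_i` is outside the range. -/
theorem single_zero_not_mem_range (ℓ ℓ' : Fin m → AffForm n) (x₀ : Fin n → ZMod 2)
    (hx₀ : ∀ i, (ℓ i).eval x₀ = 1 ∧ (ℓ' i).eval x₀ = 1) (i : Fin m)
    (h₁ : (ℓ i).lin ∈ W ℓ ℓ' i) (h₂ : (ℓ' i).lin ∈ W ℓ ℓ' i) :
    (fun j => if j = i then (0 : ZMod 2) else 1) ∉ Set.range (prodMap ℓ ℓ') := by
  rintro ⟨x, hx⟩
  set u : Fin n → ZMod 2 := x - x₀ with hu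
  -- every other output equals 1 at x, so its forms are 1 at x, so their linear parts kill u
  have hker : W ℓ ℓ' i ≤ LinearMap.ker (dotWith u) := by
    refine Submodule.span_le.2 ?_
    rintro v (⟨j, hj, rfl⟩ | ⟨j, hj, rfl⟩) <;>
    · simp only [Set.mem_setOf_eq] at hj
      have hxj : (ℓ j).eval x * (ℓ' j).eval x = 1 := by
        simpa [prodMap, hj] using congrFun hx j
      obtain ⟨ha, hb⟩ := (mul_eq_one_iff _ _).1 hxj
      simp only [SetLike.mem_coe, LinearMap.mem_ker, dotWith, LinearMap.coe_mk, AddHom.coe_mk]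
      first
        | (have e := (ℓ j).eval_eq x x₀; rw [ha, (hx₀ j).1] at e; simpa [hu] using e.symm)
        | (have e := (ℓ' j).eval_eq x x₀; rw [hb, (hx₀ j).2] at e; simpa [hu] using e.symm)
  have k₁ : ∑ k, (ℓ i).lin k * u k = 0 := by simpa [dotWith] using hker h₁
  have k₂ : ∑ k, (ℓ' i).lin k * u k = 0 := by simpa [dotWith] using hker h₂
  have e₁ : (ℓ i).eval x = 1 := by rw [(ℓ i).eval_eq x x₀, (hx₀ i).1, ← hu, k₁, add_zero]
  have e₂ : (ℓ' i).eval x = 1 := by rw [(ℓ' i).eval_eq x x₀, (hx₀ i).2, ← hu, k₂, add_zero]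
  have := congrFun hx i
  simp [prodMap, e₁, e₂] at this

/-- The bad indices of one kind carry linearly independent linear parts. -/
theorem linearIndependent_bad (v : Fin m → Fin n → ZMod 2) (Wi : Fin m → Submodule (ZMod 2) (Fin n → ZMod 2))
    (hW : ∀ i j, j ≠ i → v j ∈ Wi i) (B : Finset (Fin m)) (hB : ∀ i ∈ B, v i ∉ Wi i) :
    LinearIndependent (ZMod 2) (fun i : B => v i) := by
  rw [linearIndependent_iff']
  intro s g hs i hi
  by_contra hgi
  have hg1 : g i = 1 := zmod2_eq_one_of_ne_zero _ hgi
  -- v i = Σ_{s \ i} g • v ∈ Wi i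
  have hsplit := Finset.add_sum_erase s (fun i => g i • v (i : Fin m)) hi
  rw [hs, hg1, one_smul] at hsplit
  have hvi : v i = -∑ x ∈ s.erase i, g x • v (x : Fin m) := eq_neg_of_add_eq_zero_left hsplit
  have hmem : v i ∈ Wi i := by
    rw [hvi]
    refine Submodule.neg_mem _ (Submodule.sum_mem _ fun j hj => Submodule.smul_mem _ _ ?_)
    exact hW i j (fun e => (Finset.ne_of_mem_erase hj) (Subtype.ext e))
  exact hB i i.2 hmem

/-- Hence at most `n` bad indices of one kind. -/
theorem card_bad_le (v : Fin m → Fin n → ZMod 2) (Wi : Fin m → Submodule (ZMod 2) (Fin n → ZMod 2))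
    (hW : ∀ i j, j ≠ i → v j ∈ Wi i) (B : Finset (Fin m)) (hB : ∀ i ∈ B, v i ∉ Wi i) :
    B.card ≤ n := by
  have h := (linearIndependent_bad v Wi hW B hB).fintype_card_le_finrank
  simpa using h

/-- **Rule 2 (existence).** With `m ≥ 2n + 1` outputs some index is good. -/
theorem exists_good (hm : 2 * n < m) (ℓ ℓ' : Fin m → AffForm n) :
    ∃ i, (ℓ i).lin ∈ W ℓ ℓ' i ∧ (ℓ' i).lin ∈ W ℓ ℓ' i := by
  classical
  by_contra h
  push Not at h
  set B₁ := Finset.univ.filter fun i => (ℓ i).lin ∉ W ℓ ℓ' i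
  set B₂ := Finset.univ.filter fun i => (ℓ' i).lin ∉ W ℓ ℓ' i
  have hW₁ : ∀ i j, j ≠ i → (ℓ j).lin ∈ W ℓ ℓ' i := fun i j hj =>
    Submodule.subset_span (Or.inl ⟨j, hj, rfl⟩)
  have hW₂ : ∀ i j, j ≠ i → (ℓ' j).lin ∈ W ℓ ℓ' i := fun i j hj =>
    Submodule.subset_span (Or.inr ⟨j, hj, rfl⟩)
  have c₁ := card_bad_le (fun j => (ℓ j).lin) (W ℓ ℓ') hW₁ B₁ (fun i hi => (Finset.mem_filter.1 hi).2)
  have c₂ := card_bad_le (fun j => (ℓ' j).lin) (W ℓ ℓ') hW₂ B₂ (fun i hi => (Finset.mem_filter.1 hi).2)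
  have hcover : (Finset.univ : Finset (Fin m)) ⊆ B₁ ∪ B₂ := by
    intro i _
    rw [Finset.mem_union, Finset.mem_filter, Finset.mem_filter]
    by_cases h1 : (ℓ i).lin ∈ W ℓ ℓ' i
    · exact Or.inr ⟨Finset.mem_univ _, h i h1⟩
    · exact Or.inl ⟨Finset.mem_univ _, h1⟩
  have := (Finset.card_le_card hcover).trans (Finset.card_union_le _ _)
  rw [Finset.card_univ, Fintype.card_fin] at this
  omega

/-- **The rule, assembled.** For `m ≥ 2n + 1` outputs that are products of two affine forms over `𝔽₂`:
either the all-ones point is outside the range (when no `x` makes every form `1`), or for any `x₀` making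
every form `1` there is an index `i` — characterised by two span memberships, i.e. rank tests — such that
`1^m − e_i` is outside the range. -/
theorem avoid_rule (hm : 2 * n < m) (ℓ ℓ' : Fin m → AffForm n) :
    ((¬ ∃ x, ∀ i, (ℓ i).eval x = 1 ∧ (ℓ' i).eval x = 1) →
        (fun _ => (1 : ZMod 2)) ∉ Set.range (prodMap ℓ ℓ')) ∧
    (∀ x₀, (∀ i, (ℓ i).eval x₀ = 1 ∧ (ℓ' i).eval x₀ = 1) →
        ∃ i, ((ℓ i).lin ∈ W ℓ ℓ' i ∧ (ℓ' i).lin ∈ W ℓ ℓ' i) ∧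
          (fun j => if j = i then (0 : ZMod 2) else 1) ∉ Set.range (prodMap ℓ ℓ')) :=
  ⟨ones_not_mem_range ℓ ℓ', fun x₀ hx₀ => by
    obtain ⟨i, h₁, h₂⟩ := exists_good hm ℓ ℓ'
    exact ⟨i, ⟨h₁, h₂⟩, single_zero_not_mem_range ℓ ℓ' x₀ hx₀ i h₁ h₂⟩⟩

end Summit.PneNP.PneNP.Theorems.RankOneQuadAvoid
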